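/-
Origin: expansion seat `planner-pub-hodgecm-pv14-g6-0`, handover import Pv14g6.SchwartzScalarProductRule -> import HodgeCM.Automorphic.SchwartzScalarProductRule ; import Pv14g6.SchwartzFlowSmooth -> import HodgeCM.Automorphic.SchwartzFlowSmooth ; after t31 rows 4 (SchwartzScalarProductRule) and 6 (SchwartzFlowSmooth) (`HOME/pub-hodgecm-pv14-g6/lean/Pv14g6/SchwartzWeightedFlowDeriv.lean`, md5 30c2f918, 172 lines);
landed by the gen-8 packager in gate run 31 as `HodgeCM/Automorphic/SchwartzWeightedFlowDeriv.lean` (import ^import Pv14g6\.SchwartzScalarProductRule[ \t]*$→import HodgeCM.Automorphic.SchwartzScalarProductRule ×1; import ^import Pv14g6\.SchwartzFlowSmooth[ \t]*$→import HodgeCM.Automorphic.SchwartzFlowSmooth ×1).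
-/
/-
Copyright: HodgeCM public adjudication package, seat pub-hodgecm-pv14-g6 (DAG-NODE PROVER #14, gen 6).
File #22 of this seat.  Kernel-checked, no new axioms.  Imports files #19 and #21 (hence #16, #20, #15)
of this seat and Mathlib only.
-/
import Summits.HodgeConjecture.HodgeCM.Automorphic.SchwartzScalarProductRule
import Summits.HodgeConjecture.HodgeCM.Automorphic.SchwartzFlowSmooth
import Mathlib.Analysis.SpecialFunctions.ExpDeriv

/-!
# Weighted linear flows `s ↦ c(s) • (Φ ∘ L s)` on Schwartz space (Levi / metaplectic shape)

The one-parameter groups by which a Levi factor acts in a Schrödinger-type model have the shape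
`Φ ↦ c(s) • (Φ ∘ L s)`: a linear flow `L s` on the base space twisted by a scalar cocycle `c(s)`
(a modulus character `|det|^{1/2}` and/or a unitary character).  For such weighted flows on `𝓢(E, F)`,
`E`, `F` arbitrary real normed spaces, `𝕜 = ℝ` or `ℂ`, `c : ℝ → 𝕜` with `c 0 = 1`, `c'(0) = κ`, and
`L` with `L 0 = 1` and operator-norm derivative `A` at `0`:

* `tendsto_smul_compCLM_sub_div`: `s⁻¹ • (c s • (Φ ∘ L s) - Φ) → κ • Φ + flowGen A Φ` in `𝓢(E, F)`;
* `tendsto_smul_compCLM_sub_div_at`: the same at every base point when `c` is multiplicative and `L`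
  is a group; `hasDerivAt_apply_smul_compCLM`: every scalar coefficient `s ↦ T (c s • (Φ ∘ L s))`
  is differentiable on `ℝ`; `contDiff_apply_smul_compCLM`: it is `C^∞`, with iterated derivatives
  `T ((weightedFlowGen κ A)^[k] (…))` (`iteratedDeriv_apply_smul_compCLM`);
* the example `s ↦ e^{κ s} • Φ(e^s ·)` (`tendsto_expWeight_dilation_sub_div_at`,
  `contDiff_apply_expWeight_dilation`), generator `κ + x·∇`.

Inputs: #16 `tendsto_compCLM_sub_div`, #19 `tendsto_smul_sub_div`, #21 `contDiff_infty_apply_of_hasDerivAt_comp`.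
Only published mathematics is used (Mathlib); nothing here refers to the objects under adjudication.
-/

noncomputable section

open Filter Topology
open scoped SchwartzMap ContDiff

namespace HodgeCM
namespace SchwartzWeil

variable {E F G : Type*} [NormedAddCommGroup E] [NormedSpace ℝ E] [NormedAddCommGroup F]
  [NormedSpace ℝ F] [NormedAddCommGroup G] [NormedSpace ℝ G]

section Weighted

variable (𝕜 : Type*) [RCLike 𝕜] [NormedSpace 𝕜 F] [SMulCommClass ℝ 𝕜 F] [IsScalarTower ℝ 𝕜 F]
variable {c : ℝ → 𝕜} {κ : 𝕜} {L : ℝ → E ≃L[ℝ] E} {A : E →L[ℝ] E}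

/-- The generator of a weighted linear flow: `weightedFlowGen κ A Ψ = κ • Ψ + flowGen A Ψ`, as a real
continuous linear operator on `𝓢(E, F)`. -/
def weightedFlowGen (κ : 𝕜) (A : E →L[ℝ] E) : 𝓢(E, F) →L[ℝ] 𝓢(E, F) :=
  (κ • ContinuousLinearMap.id 𝕜 𝓢(E, F)).restrictScalars ℝ + flowGen A

variable {𝕜} in
/-- (Ported verbatim from the HodgeCMPerL package; no docstring in the source.) -/
@[simp] theorem weightedFlowGen_apply (κ : 𝕜) (A : E →L[ℝ] E) (Ψ : 𝓢(E, F)) :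
    weightedFlowGen 𝕜 κ A Ψ = κ • Ψ + flowGen A Ψ := rfl

/-- **Weighted linear flows at `s = 0`**: `s⁻¹ • (c s • (Φ ∘ L s) - Φ) → κ • Φ + flowGen A Φ`. -/
theorem tendsto_smul_compCLM_sub_div (hc0 : c 0 = 1) (hc : HasDerivAt c κ 0)
    (hL0 : ((L 0 : E ≃L[ℝ] E) : E →L[ℝ] E) = 1)
    (hL : HasDerivAt (fun s => ((L s : E ≃L[ℝ] E) : E →L[ℝ] E)) A 0) (Φ : 𝓢(E, F)) :
    Tendsto (fun s : ℝ => s⁻¹ • (c s • SchwartzMap.compCLMOfContinuousLinearEquiv 𝕜 (L s) Φ - Φ))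
      (𝓝[≠] 0) (𝓝 (κ • Φ + flowGen A Φ)) :=
  tendsto_smul_sub_div hc0 hc (tendsto_compCLM_sub_div 𝕜 hL0 hL Φ)

/-- **Weighted linear flows at every base point** (`c` multiplicative, `L` a group): with
`Ψ = c s₀ • (Φ ∘ L s₀)`, `s⁻¹ • (c (s₀+s) • (Φ ∘ L (s₀+s)) - Ψ) → κ • Ψ + flowGen A Ψ`. -/
theorem tendsto_smul_compCLM_sub_div_at (hc0 : c 0 = 1) (hc : HasDerivAt c κ 0)
    (hcmul : ∀ s t, c (s + t) = c s * c t)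
    (hL0 : ((L 0 : E ≃L[ℝ] E) : E →L[ℝ] E) = 1)
    (hL : HasDerivAt (fun s => ((L s : E ≃L[ℝ] E) : E →L[ℝ] E)) A 0)
    (hmul : ∀ s t x, L (s + t) x = L s (L t x)) (Φ : 𝓢(E, F)) (s₀ : ℝ) :
    Tendsto (fun s : ℝ => s⁻¹ • (c (s₀ + s) • SchwartzMap.compCLMOfContinuousLinearEquiv 𝕜 (L (s₀ + s)) Φ
        - c s₀ • SchwartzMap.compCLMOfContinuousLinearEquiv 𝕜 (L s₀) Φ)) (𝓝[≠] 0)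
      (𝓝 (κ • (c s₀ • SchwartzMap.compCLMOfContinuousLinearEquiv 𝕜 (L s₀) Φ)
        + flowGen A (c s₀ • SchwartzMap.compCLMOfContinuousLinearEquiv 𝕜 (L s₀) Φ))) := by
  have key : ∀ s : ℝ, c (s₀ + s) • SchwartzMap.compCLMOfContinuousLinearEquiv 𝕜 (L (s₀ + s)) Φ
      = c s • SchwartzMap.compCLMOfContinuousLinearEquiv 𝕜 (L s)
          (c s₀ • SchwartzMap.compCLMOfContinuousLinearEquiv 𝕜 (L s₀) Φ) := by
    intro s
    have h1 : SchwartzMap.compCLMOfContinuousLinearEquiv 𝕜 (L (s₀ + s)) Φ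
        = SchwartzMap.compCLMOfContinuousLinearEquiv 𝕜 (L s)
            (SchwartzMap.compCLMOfContinuousLinearEquiv 𝕜 (L s₀) Φ) := by
      ext x
      simp [hmul]
    rw [h1, map_smul, smul_smul, hcmul, mul_comm]
  simp only [key]
  exact tendsto_smul_compCLM_sub_div 𝕜 hc0 hc hL0 hL _

/-- Scalar coefficients of a weighted linear one-parameter group are differentiable everywhere:
`d/ds T (c s • (Φ ∘ L s)) |_{s₀} = T (weightedFlowGen κ A (c s₀ • (Φ ∘ L s₀)))`. -/
theorem hasDerivAt_apply_smul_compCLM (T : 𝓢(E, F) →L[ℝ] G) (hc0 : c 0 = 1)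
    (hc : HasDerivAt c κ 0) (hcmul : ∀ s t, c (s + t) = c s * c t)
    (hL0 : ((L 0 : E ≃L[ℝ] E) : E →L[ℝ] E) = 1)
    (hL : HasDerivAt (fun s => ((L s : E ≃L[ℝ] E) : E →L[ℝ] E)) A 0)
    (hmul : ∀ s t x, L (s + t) x = L s (L t x)) (Φ : 𝓢(E, F)) (s₀ : ℝ) :
    HasDerivAt (fun s : ℝ => T (c s • SchwartzMap.compCLMOfContinuousLinearEquiv 𝕜 (L s) Φ))
      (T (weightedFlowGen 𝕜 κ A (c s₀ • SchwartzMap.compCLMOfContinuousLinearEquiv 𝕜 (L s₀) Φ))) s₀ := by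
  rw [hasDerivAt_iff_tendsto_slope_zero, weightedFlowGen_apply]
  have h := (T.continuous.tendsto _).comp
    (tendsto_smul_compCLM_sub_div_at 𝕜 hc0 hc hcmul hL0 hL hmul Φ s₀)
  refine h.congr fun s => ?_
  simp only [Function.comp_apply, map_smul, map_sub]

/-- **Scalar smoothness of weighted linear one-parameter groups**: `s ↦ T (c s • (Φ ∘ L s))` is `C^∞`. -/
theorem contDiff_apply_smul_compCLM (T : 𝓢(E, F) →L[ℝ] G) (hc0 : c 0 = 1)
    (hc : HasDerivAt c κ 0) (hcmul : ∀ s t, c (s + t) = c s * c t)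
    (hL0 : ((L 0 : E ≃L[ℝ] E) : E →L[ℝ] E) = 1)
    (hL : HasDerivAt (fun s => ((L s : E ≃L[ℝ] E) : E →L[ℝ] E)) A 0)
    (hmul : ∀ s t x, L (s + t) x = L s (L t x)) (Φ : 𝓢(E, F)) :
    ContDiff ℝ ∞ (fun s : ℝ => T (c s • SchwartzMap.compCLMOfContinuousLinearEquiv 𝕜 (L s) Φ)) :=
  contDiff_infty_apply_of_hasDerivAt_comp (N := weightedFlowGen 𝕜 κ A)
    (γ := fun s : ℝ => c s • SchwartzMap.compCLMOfContinuousLinearEquiv 𝕜 (L s) Φ)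
    (fun T s => hasDerivAt_apply_smul_compCLM 𝕜 T hc0 hc hcmul hL0 hL hmul Φ s) T

/-- The iterated derivatives: `(d/ds)^k T (c s • (Φ ∘ L s)) = T ((weightedFlowGen κ A)^[k] (c s • (Φ ∘ L s)))`. -/
theorem iteratedDeriv_apply_smul_compCLM (T : 𝓢(E, F) →L[ℝ] G) (hc0 : c 0 = 1)
    (hc : HasDerivAt c κ 0) (hcmul : ∀ s t, c (s + t) = c s * c t)
    (hL0 : ((L 0 : E ≃L[ℝ] E) : E →L[ℝ] E) = 1)
    (hL : HasDerivAt (fun s => ((L s : E ≃L[ℝ] E) : E →L[ℝ] E)) A 0)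
    (hmul : ∀ s t x, L (s + t) x = L s (L t x)) (Φ : 𝓢(E, F)) (k : ℕ) :
    iteratedDeriv k (fun s : ℝ => T (c s • SchwartzMap.compCLMOfContinuousLinearEquiv 𝕜 (L s) Φ))
      = fun s => T ((weightedFlowGen 𝕜 κ A)^[k]
          (c s • SchwartzMap.compCLMOfContinuousLinearEquiv 𝕜 (L s) Φ)) :=
  iteratedDeriv_apply_of_hasDerivAt_comp (N := weightedFlowGen 𝕜 κ A)
    (γ := fun s : ℝ => c s • SchwartzMap.compCLMOfContinuousLinearEquiv 𝕜 (L s) Φ)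
    (fun T s => hasDerivAt_apply_smul_compCLM 𝕜 T hc0 hc hcmul hL0 hL hmul Φ s) k T

end Weighted

/-! ## Example: `s ↦ e^{κ s} • Φ(e^s ·)` — dilation with a modulus-type weight -/

section ExpDilation

/-- The weight `s ↦ e^{κ s}`: value `1` and derivative `κ` at `0`, multiplicative. -/
theorem hasDerivAt_expWeight (κ : ℝ) : HasDerivAt (fun s : ℝ => Real.exp (κ * s)) κ 0 := by
  have h := ((hasDerivAt_id (0 : ℝ)).const_mul κ).exp
  simpa using h

/-- (Ported verbatim from the HodgeCMPerL package; no docstring in the source.) -/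
theorem expWeight_add (κ s t : ℝ) : Real.exp (κ * (s + t)) = Real.exp (κ * s) * Real.exp (κ * t) := by
  rw [mul_add, Real.exp_add]

/-- **`s ↦ e^{κ s} Φ(e^s ·)` at every base point**: with `Ψ = e^{κ s₀} Φ(e^{s₀} ·)`,
`s⁻¹ • (e^{κ(s₀+s)} Φ(e^{s₀+s} ·) - Ψ) → κ • Ψ + (x·∇) Ψ` in `𝓢(E, F)`. -/
theorem tendsto_expWeight_dilation_sub_div_at (κ : ℝ) (Φ : 𝓢(E, F)) (s₀ : ℝ) :
    Tendsto (fun s : ℝ => s⁻¹ • (Real.exp (κ * (s₀ + s))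
        • SchwartzMap.compCLMOfContinuousLinearEquiv ℝ (dilation E (s₀ + s)) Φ
        - Real.exp (κ * s₀) • SchwartzMap.compCLMOfContinuousLinearEquiv ℝ (dilation E s₀) Φ)) (𝓝[≠] 0)
      (𝓝 (κ • (Real.exp (κ * s₀) • SchwartzMap.compCLMOfContinuousLinearEquiv ℝ (dilation E s₀) Φ)
        + flowGen (1 : E →L[ℝ] E)
          (Real.exp (κ * s₀) • SchwartzMap.compCLMOfContinuousLinearEquiv ℝ (dilation E s₀) Φ))) :=
  tendsto_smul_compCLM_sub_div_at ℝ (by simp) (hasDerivAt_expWeight κ) (expWeight_add κ)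
    (coe_dilation_zero E) (hasDerivAt_coe_dilation E) (dilation_add_apply E) Φ s₀

/-- Every scalar coefficient `s ↦ T (e^{κ s} Φ(e^s ·))` is `C^∞` on `ℝ`. -/
theorem contDiff_apply_expWeight_dilation (T : 𝓢(E, F) →L[ℝ] G) (κ : ℝ) (Φ : 𝓢(E, F)) :
    ContDiff ℝ ∞ (fun s : ℝ => T (Real.exp (κ * s)
      • SchwartzMap.compCLMOfContinuousLinearEquiv ℝ (dilation E s) Φ)) :=
  contDiff_apply_smul_compCLM ℝ T (by simp) (hasDerivAt_expWeight κ) (expWeight_add κ)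
    (coe_dilation_zero E) (hasDerivAt_coe_dilation E) (dilation_add_apply E) Φ

/-- … with iterated derivatives `T ((κ + x·∇)^k (e^{κ s} Φ(e^s ·)))`. -/
theorem iteratedDeriv_apply_expWeight_dilation (T : 𝓢(E, F) →L[ℝ] G) (κ : ℝ) (Φ : 𝓢(E, F)) (k : ℕ) :
    iteratedDeriv k (fun s : ℝ => T (Real.exp (κ * s)
      • SchwartzMap.compCLMOfContinuousLinearEquiv ℝ (dilation E s) Φ))
      = fun s => T ((weightedFlowGen ℝ κ (1 : E →L[ℝ] E))^[k]
          (Real.exp (κ * s) • SchwartzMap.compCLMOfContinuousLinearEquiv ℝ (dilation E s) Φ)) :=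
  iteratedDeriv_apply_smul_compCLM ℝ T (by simp) (hasDerivAt_expWeight κ) (expWeight_add κ)
    (coe_dilation_zero E) (hasDerivAt_coe_dilation E) (dilation_add_apply E) Φ k

end ExpDilation

end SchwartzWeil
end HodgeCM
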